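import Literature.Computability.AlgebraicComplexity.PerDetHwvCertificateSemantics
import Literature.Computability.AlgebraicComplexity.DIP20MultiplicityObstructions
import HarnessLib

/-!
# Tableau certificates at EXPLICIT points: evaluation-rank lower bounds for the multiplicity of a
# type in the coordinate ring of a SET of forms, and the fast leaf for power-sum points

Glue file (cell `val-lit`, DIP20 lane; honest framing below) extending the Lean checker of tableau
highest-weight-vector certificates (`PlethysmTableauEvaluation.lean`, `TableauPolynomial.lean`,
`TableauHighestWeight.lean`, `TableauEvalClosedForm.lean`, `HwvEvaluationRankBound.lean`,
`PerDetHwvCertificateSemantics.lean` — written for the orbit closure of the padded permanent) to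
the setting of Dörfler–Ikenmeyer–Panova 2020 §5–§6: the multiplicity `mult_λ(ℂ[Z̄]_d)` of a type in
the coordinate ring of an ARBITRARY set `Z ⊆ 𝔸_m^n` of forms (tree: `coordRingMultiplicity`,
`DIP20MultiplicityObstructions.lean`), bounded below by the rank of the evaluation matrix of tableau
highest-weight vectors at explicitly listed points of `Z` ("8 tableaux that index a basis of
`HWV_{(34,6,2)}(ℂ[𝔸_3^6]_7)` … evaluated at 8 random points of `Pow_{3,4}^6`", DIP §6, arXiv p. 15).

Contents:
* §1 `le_coordRingMultiplicity_of_det_eval_ne_zero` — **the principle for sets**: highest-weight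
  vectors `F_0,…,F_{r-1}` of weight `χ` in `k[Sym^m]` and points `q_0,…,q_{r-1} ∈ Z` with
  `det (F_i(q_j)) ≠ 0` give `r ≤ coordRingMultiplicity k Z m χ = a_χ − dim (HWV_χ ∩ I(Z))`
  (a vanishing combination in `I(Z)` vanishes at every `q_j`; `Matrix.exists_vecMul_eq_zero_iff`);
* §2 the reversed enumeration `finRevEnum N` of `Fin N` (certificate variable `i` ↦ `N-1-i`, so that
  canonical column alternators sit on the LARGEST variables, the tree's upper-triangular Borel) and the
  weight bookkeeping `dualOfPartition_finRevEnum_x` (`λ^*(x_i) = -λ_{i+1}`);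
* §3 **power-sum points**: `powPoint m L = ∑_t c_t ℓ_t^m` presented as `m` equal forms per term, the
  closed leaf `symEntryPow` (`= c_t · m! · ∏_s ℓ_t(w_s)`, the permanent of `m` equal rows,
  `lperm_eq_permanent`) and the evaluator `evalCPow` with **`evalCPow_eq_evalC`** — the naive leaf
  enumerates `m!` permutations per label, this one none, which is what makes degree-7/8 certificates on
  ternary sextics/septics kernel-checkable;
* §4 **`le_coordRingMultiplicity_of_certificate`** — the assembled statement for `σ = Fin N`: networks
  passing `Network.check` with canonical alternators and shape `λ`, integer points whose presentations
  lie in `Z`, and a nonsingular INTEGER evaluation matrix `(evalC P_j N_i)` give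
  `r ≤ coordRingMultiplicity K Z m λ^*` over any field `K` of characteristic zero
  (`TabM.tabPoly_mem_highestWeightSpace`, `TabM.aeval_formCoeff_tabPoly`, `TabM.EC_ofNetwork`, §1);
  `det_ne_zero_of_map_zmod` / `det_ne_zero_of_mul_eq_one` reduce the nonsingularity to a right inverse
  modulo one number `p > 1`;
* §5 `splfPoly_powPoint_mem_powerSumSet` — the form presented by `powPoint m [(1,ℓ_0),…,(1,ℓ_{k-1})]` is
  `∑_t ℓ_t^m ∈ powerSumSet K N k m` (DIP's `Pow_{N,k}^m`);
* §6 **`le_coordRingMultiplicity_powerSumSet_of_listCertificate`** — the LIST form a certificate file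
  instantiates: networks, integer power-sum points, the table of `evalCPow` values (one kernel lemma per
  entry) and a right inverse of the table mod `p` give `r ≤ mult_{λ^*} K[Pow_{N,k}^m]`.

HONEST FRAMING: certificate-checking plumbing for the toy model `Pow ⊄ Ch` of DIP 2020 and similar
finite computations; nothing here bears on permanent versus determinant; VP ≠ VNP is not proved.

## References
* [DorflerIkenmeyerPanova2020] J. Dörfler, C. Ikenmeyer, G. Panova, *On geometric complexity theory:
  multiplicity obstructions are stronger than occurrence obstructions*, SIAM J. Appl. Algebra Geom. 4
  (2020) = arXiv:1901.04576, §5 (eqs. (5.3)–(5.6)), §6, Prop. 3.2.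
* [BurgisserIkenmeyer2013] P. Bürgisser, C. Ikenmeyer, *Explicit lower bounds via geometric complexity
  theory*, STOC 2013, §4.

## Mathlib and tree
Mathlib: `Matrix.exists_vecMul_eq_zero_iff`, `Submodule.finrank_quotient_add_finrank`,
`Submodule.comapSubtypeEquivOfLe`, `LinearIndependent.fintype_card_le_finrank`,
`Matrix.permanent`, `RingHom.map_det`, `MvPolynomial.mem_vanishingIdeal_iff`.
Tree: `coordRingMultiplicity` (`DIP20MultiplicityObstructions`); `TableauEval.evalC`, `symEntry`,
`lperm`, `Point`, `Network` (`PlethysmTableauEvaluation`); `lperm_eq_permanent`, `matOfRows`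
(`PlethysmTableauPerms`); `Point.map`, `evalC_map` (`PerDetHwvCertificateProofs`); `Enum`, `coefM`,
`formM` (`TableauEvalBridge`); `TabM.ofNetwork`, `NetFrame.ofCounts`, `TabM.EC_ofNetwork`
(`TableauEvalClosedForm`); `TabM.tabPoly_mem_highestWeightSpace`, `IsAntitoneEnum`
(`TableauHighestWeight`, `TableauScaling`); `Network.spec_of_check`, `height_le_length`,
`get_vars_of_canonical` (`PerDetHwvCertificateSemantics`); `card_filter_height_eq`
(`PerDetHwvCertificateWeights`); `finiteDimensional_highestWeightSpace_coordRep_holds`.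

Provenance: val-lit cell, prover val-lit-p6 g3 (DIP20 Prop. 3.2 certificates).
-/

noncomputable section

open scoped BigOperators

namespace Literature.Computability.AlgebraicComplexity

namespace TableauEval

open MvPolynomial
open _root_.Literature.NumberTheory.DiophantineGeometry

/-! ## §1 The evaluation-rank principle for a set of forms -/

section SetPrinciple

variable {σ : Type} [Fintype σ] [LinearOrder σ] {k : Type} [Field k]

/-- **Evaluation-rank lower bound for `mult_χ k[Z̄]`** (DIP 2020 §5, eqs. (5.3)–(5.6): "our goal is to
find a nonzero vector in `HWV_λ` … that does not vanish", in its rank form): if `F_0,…,F_{r-1}` are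
highest-weight vectors of weight `χ` among the polynomial functions on `Sym^m (k^σ)` and
`q_0,…,q_{r-1} ∈ Z` make the evaluation matrix `(F_i(q_j))` nonsingular, then
`r ≤ coordRingMultiplicity k Z m χ` (`= a_χ − dim (HWV_χ ∩ I(Z))`; characteristic zero, `m ≠ 0`, so
that `HWV_χ` is finite-dimensional). No genericity of the points is needed.
[cite: DorflerIkenmeyerPanova2020, §5 eqs. (5.3)–(5.6) (arXiv p. 13)] -/
theorem le_coordRingMultiplicity_of_det_eval_ne_zero [CharZero k] {Z : Set (MvPolynomial σ k)}
    {m : ℕ} (hm : m ≠ 0) {χ : Weight σ} {r : ℕ} (F : Fin r → MvPolynomial (DegIdx σ m) k)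
    (hF : ∀ i, F i ∈ highestWeightSpace (coordRep σ k m) χ) (q : Fin r → MvPolynomial σ k)
    (hq : ∀ j, q j ∈ Z)
    (hdet : (Matrix.of fun i j => aeval (formCoeff m (q j)) (F i)).det ≠ 0) :
    r ≤ coordRingMultiplicity k Z m χ := by
  classical
  haveI : Infinite k := CharZero.infinite k
  haveI : FiniteDimensional k ↥(highestWeightSpace (coordRep σ k m) χ) :=
    finiteDimensional_highestWeightSpace_coordRep_holds hm χ
  set H := highestWeightSpace (coordRep σ k m) χ with hH
  set J := H ⊓ (MvPolynomial.vanishingIdeal k (formCoeff m '' Z)).restrictScalars k with hJ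
  have hJH : J ≤ H := inf_le_left
  -- `J` seen inside `H`
  set J' : Submodule k ↥H := Submodule.comap H.subtype J with hJ'
  have hfinJ : Module.finrank k ↥J' = Module.finrank k ↥J :=
    (Submodule.comapSubtypeEquivOfLe hJH).finrank_eq
  have hquot : Module.finrank k (↥H ⧸ J') + Module.finrank k ↥J' = Module.finrank k ↥H :=
    Submodule.finrank_quotient_add_finrank J'
  have hdef : coordRingMultiplicity k Z m χ = Module.finrank k ↥H - Module.finrank k ↥J := rfl
  -- the classes of the `F i` in `H ⧸ J'` are linearly independent
  let v : Fin r → ↥H ⧸ J' := fun i => J'.mkQ ⟨F i, hF i⟩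
  have hv : LinearIndependent k v := by
    rw [Fintype.linearIndependent_iff]
    intro c hc
    have hsum : J'.mkQ (∑ i, c i • (⟨F i, hF i⟩ : ↥H)) = 0 := by
      rw [← hc]
      simp only [v, map_sum, map_smul]
    rw [Submodule.mkQ_apply, Submodule.Quotient.mk_eq_zero, hJ', Submodule.mem_comap,
      Submodule.subtype_apply] at hsum
    have hmemI : (∑ i, c i • F i) ∈ MvPolynomial.vanishingIdeal k (formCoeff m '' Z) := by
      have h2 := (Submodule.mem_inf.mp hsum).2
      rw [Submodule.restrictScalars_mem] at h2
      have hval : ((∑ i, c i • (⟨F i, hF i⟩ : ↥H) : ↥H) : MvPolynomial (DegIdx σ m) k) =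
          ∑ i, c i • F i := by
        rw [Submodule.coe_sum]
        rfl
      rwa [hval] at h2
    -- hence `c ᵥ* M = 0`
    have hvec : Matrix.vecMul c (Matrix.of fun i j => aeval (formCoeff m (q j)) (F i)) = 0 := by
      funext j
      have h := (MvPolynomial.mem_vanishingIdeal_iff.mp hmemI) (formCoeff m (q j)) ⟨q j, hq j, rfl⟩
      rw [map_sum] at h
      simp only [map_smul, smul_eq_mul] at h
      simpa [Matrix.vecMul, dotProduct, Matrix.of_apply] using h
    by_contra hne
    obtain ⟨i, hi⟩ := not_forall.mp hne
    exact hdet (Matrix.exists_vecMul_eq_zero_iff.mp ⟨c, fun h0 => hi (congr_fun h0 i), hvec⟩)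
  have hr : r ≤ Module.finrank k (↥H ⧸ J') := by
    simpa only [Fintype.card_fin] using hv.fintype_card_le_finrank
  rw [hdef]
  omega

end SetPrinciple

/-! ## §2 The reversed enumeration of `Fin N` and the weight `λ^*` at its variables -/

section FinEnum

/-- **The reversed enumeration of `Fin N`**: certificate variable `i < N` is the `i`-th LARGEST
element `N-1-i` of `Fin N` (so that a canonical column alternator on the certificate variables
`0,…,h-1` is an alternator on the `h` largest variables, a semi-invariant for the tree's
upper-triangular Borel); indices `≥ N` are sent to `0` (junk, never used). [folklore] -/
def finRevEnum (N : ℕ) [NeZero N] : Enum (Fin N) N where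
  x i := if h : i < N then Fin.rev ⟨i, h⟩ else 0
  xinv v := (Fin.rev v : ℕ)
  xinv_lt v := (Fin.rev v).isLt
  x_xinv v := by
    rw [dif_pos (Fin.rev v).isLt]
    ext
    simp only [Fin.val_rev]
    omega
  xinv_x i hi := by
    rw [dif_pos hi, Fin.rev_rev]

/-- The reversed enumeration is antitone and exhaustive. [folklore] -/
private theorem isAntitoneEnum_finRev (N : ℕ) [NeZero N] : IsAntitoneEnum (finRevEnum N).x N where
  anti i j hij hj := by
    have hi : i < N := lt_trans hij hj
    show (if h : j < N then Fin.rev ⟨j, h⟩ else 0) < (if h : i < N then Fin.rev ⟨i, h⟩ else 0)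
    rw [dif_pos hj, dif_pos hi, Fin.lt_def]
    simp only [Fin.val_rev]
    omega
  surj v := ⟨(finRevEnum N).xinv v, (finRevEnum N).xinv_lt v, (finRevEnum N).x_xinv v⟩

/-- **`λ^*` at `x_i` is `-λ_{i+1}`**: the tree's dual weight `Weight.dualOfPartition N μ` evaluated at
the `i`-th largest variable is minus the `i`-th sorted part (zero-indexed). [folklore] -/
private theorem dualOfPartition_finRevEnum_x (N : ℕ) [NeZero N] {e : ℕ} (μ : Nat.Partition e) (i : ℕ)
    (hi : i < N) :
    Weight.dualOfPartition N μ ((finRevEnum N).x i) = -((μ.sortedParts.getD i 0 : ℕ) : ℤ) := by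
  show Weight.dualOfPartition N μ (if h : i < N then Fin.rev ⟨i, h⟩ else 0) = _
  rw [dif_pos hi]
  unfold Weight.dualOfPartition Weight.dual Weight.ofPartition
  simp [Fin.rev_rev]

end FinEnum

/-! ## §3 Power-sum points and the closed leaf of the evaluator -/

section PowLeaf

variable {R : Type*} [CommRing R]

/-- **The power-sum point `∑_t c_t · ℓ_t^m`**, presented for the evaluator as `m` EQUAL linear forms
per term (data: the list of `(c_t, coefficient list of ℓ_t)`). DIP Prop. 3.2's points of
`Pow_{3,4}^n` are `∑_{j<4} ℓ_j^n`. [cite: DorflerIkenmeyerPanova2020, §2 (arXiv p. 3), §6 (p. 15)] -/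
def powPoint (m : ℕ) (L : List (R × List R)) : Point R :=
  ⟨L.map fun cl => (cl.1, List.replicate m cl.2)⟩

/-- `powPoint` commutes with ring maps. [folklore] -/
private theorem powPoint_map {S : Type*} [CommRing S] (f : R →+* S) (m : ℕ) (L : List (R × List R)) :
    (powPoint m L).map f = powPoint m (L.map fun cl => (f cl.1, cl.2.map f)) := by
  simp only [powPoint, Point.map, List.map_map]
  congr 1
  refine List.map_congr_left fun cl _ => ?_
  simp [List.map_replicate]

/-- **The closed leaf at a power-sum point**: `∑_t c_t · (m! · ∏_{i ∈ w} ℓ_t[i])` for a word `w`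
of certificate variables — the permanent of `m` equal rows is `m!` times the product
(`symEntry_powPoint`). [folklore] -/
def symEntryPow (m : ℕ) (L : List (R × List R)) (idx : List ℕ) : R :=
  (L.map fun cl => cl.1 * ((m.factorial : R) * (idx.map fun i => cl.2.getD i 0).prod)).sum

/-- The column-bijection evaluation with the closed leaf (same recursion as `evalCols`). [folklore] -/
def evalColsPow (m : ℕ) (L : List (R × List R)) : List Column → List (List ℕ) → R
  | [], acc => (acc.map (symEntryPow m L)).prod
  | c :: cs, acc =>
    ((permsSign c.vars).map fun q => sgn q.1 * evalColsPow m L cs (pushAll acc c.labels q.2)).sum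

/-- **Fast evaluator at a power-sum point**: `evalC (powPoint m L) N` without the `m!` permutations
per label of the naive leaf (`evalCPow_eq_evalC`). [folklore] -/
def evalCPow (m : ℕ) (L : List (R × List R)) (N : Network) : R :=
  evalColsPow m L N.cols (List.replicate N.nlabels [])

/-- The permanent of `m` equal rows `r` (of length `m`) is `m! · ∏ r`. [folklore] -/
private theorem lperm_replicate (m : ℕ) (r : List R) (hr : r.length = m) :
    lperm (List.replicate m r) = (m.factorial : R) * r.prod := by
  rw [lperm_eq_permanent (List.replicate m r) (List.length_replicate ..), Matrix.permanent]
  have hM : ∀ σ : Equiv.Perm (Fin m), ∏ i : Fin m, matOfRows m (List.replicate m r) (σ i) i =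
      r.prod := by
    intro σ
    have h1 : ∀ i : Fin m, matOfRows m (List.replicate m r) (σ i) i = r.getD i 0 := by
      intro i
      simp only [matOfRows, Matrix.of_apply]
      rw [List.getD_eq_getElem (List.replicate m r) [] (by simp),
        List.getElem_replicate]
    simp only [h1]
    subst hr
    rw [← List.prod_ofFn]
    congr 1
    apply List.ext_getElem (by simp)
    intro i h1 h2
    rw [List.getElem_ofFn, List.getD_eq_getElem]
  simp only [hM, Finset.sum_const, Finset.card_univ, Fintype.card_perm, Fintype.card_fin,
    nsmul_eq_mul]

/-- At a power-sum point the naive leaf `symEntry` (a sum of `lperm`s of `m` equal rows) is the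
closed leaf, for words of length `m`. [folklore] -/
private theorem symEntry_powPoint (m : ℕ) (L : List (R × List R)) (idx : List ℕ) (hidx : idx.length = m) :
    symEntry (powPoint m L) idx = symEntryPow m L idx := by
  unfold symEntry symEntryPow powPoint
  rw [List.map_map]
  congr 1
  refine List.map_congr_left fun cl _ => ?_
  simp only [Function.comp_apply, List.map_replicate]
  rw [lperm_replicate m _ (by rw [List.length_map, hidx])]

/-- Every insertion of `a` into `l` has length `|l| + 1`. [folklore] -/
private theorem length_of_mem_insertions' {α : Type*} (a : α) : ∀ (l : List α) (q : Bool × List α),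
    q ∈ insertions a l → q.2.length = l.length + 1
  | [], q, h => by simp [insertions] at h; simp [h]
  | b :: l, q, h => by
    simp only [insertions, List.mem_cons, List.mem_map] at h
    rcases h with rfl | ⟨q', hq', rfl⟩
    · simp
    · simp [length_of_mem_insertions' a l q' hq']

/-- Every signed permutation of `l` has the length of `l`. [folklore] -/
private theorem length_of_mem_permsSign' {α : Type*} : ∀ (l : List α) (q : Bool × List α),
    q ∈ permsSign l → q.2.length = l.length
  | [], q, h => by simp [permsSign] at h; simp [h]
  | a :: l, q, h => by
    rw [permsSign, List.mem_flatMap] at h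
    obtain ⟨q', hq', h⟩ := h
    rw [List.mem_map] at h
    obtain ⟨r, hr, rfl⟩ := h
    simp only [List.length_cons]
    rw [length_of_mem_insertions' a q'.2 r hr, length_of_mem_permsSign' l q' hq']

/-- `evalColsPow = evalCols` at a power-sum point, for accumulators whose final words all have
length `m`. [folklore] -/
private theorem evalColsPow_eq (m : ℕ) (L : List (R × List R)) : ∀ (cs : List Column) (acc : List (List ℕ)),
    (∀ c ∈ cs, c.vars.length = c.labels.length) → (∀ c ∈ cs, ∀ u ∈ c.labels, u < acc.length) →
    (∀ u, u < acc.length → (acc.getD u []).length + countNat u (cs.flatMap Column.labels) = m) →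
    evalColsPow m L cs acc = evalCols (powPoint m L) cs acc
  | [], acc, _, _, hlen => by
    rw [evalColsPow, evalCols]
    congr 1
    apply List.map_congr_left
    intro w hw
    obtain ⟨u, hu, rfl⟩ := List.getElem_of_mem hw
    have h := hlen u hu
    simp only [List.flatMap_nil, countNat, List.filter_nil, List.length_nil, add_zero] at h
    rw [List.getD_eq_getElem acc [] hu] at h
    exact (symEntry_powPoint m L _ h).symm
  | c :: cs, acc, hvl, hlab, hlen => by
    rw [evalColsPow, evalCols]
    congr 1
    refine List.map_congr_left fun q hq => ?_
    have hq2 : q.2.length = c.labels.length := by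
      rw [← hvl c (List.mem_cons_self ..)]
      exact length_of_mem_permsSign' c.vars q hq
    congr 1
    apply evalColsPow_eq
    · exact fun c' hc' => hvl c' (List.mem_cons_of_mem _ hc')
    · intro c' hc' u hu
      rw [length_pushAll]
      exact hlab c' (List.mem_cons_of_mem _ hc') u hu
    · intro u hu
      rw [length_pushAll] at hu
      rw [length_pushAll_getD acc c.labels q.2 hq2.symm
        (fun u' hu' => hlab c (List.mem_cons_self ..) u' hu') u]
      have h := hlen u hu
      simp only [List.flatMap_cons, countNat, List.filter_append, List.length_append] at h ⊢
      omega

/-- **The fast evaluator is the naive one at power-sum points**, for networks passing the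
structural check (`m` boxes per label, labels in range, alternator lists as long as label lists): both
compute DIP's contraction (5.6) at the point `∑_t c_t ℓ_t^m`.
[cite: DorflerIkenmeyerPanova2020, §5 eq. (5.6) (arXiv p. 13)] -/
theorem evalCPow_eq_evalC (m : ℕ) (L : List (R × List R)) (N : Network) (hN : N.check = true)
    (hm : N.perLabel = m) : evalCPow m L N = evalC (powPoint m L) N := by
  obtain ⟨hvl, hlab, hcnt⟩ := Network.spec_of_check N hN
  unfold evalCPow evalC
  apply evalColsPow_eq
  · exact hvl
  · intro c hc u hu
    rw [List.length_replicate]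
    exact hlab c hc u hu
  · intro u hu
    rw [List.length_replicate] at hu
    rw [List.getD_eq_getElem _ _ (by simpa using hu), List.getElem_replicate, List.length_nil,
      zero_add, ← hm]
    exact hcnt u hu

end PowLeaf

/-! ## §4 The certificate theorem for explicit integer points (`σ = Fin N`) -/

section Certificate

/-- Canonical alternators (hwv `FORMAT.md` §2, as in `Cert.canonical`): the column of height `h`
antisymmetrises the certificate variables `0, …, h-1`. [folklore] -/
def Network.canonicalVars (Nw : Network) : Bool :=
  Nw.cols.all fun col => col.vars == List.range col.labels.length

/-- The network with its two size fields replaced by given numbers (so that they are definitionally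
the ambient `d`, `m`; equal to the network itself when the fields agree, `sized_eq`). [folklore] -/
def Network.sized (d m : ℕ) (Nw : Network) : Network := ⟨d, m, Nw.cols⟩

/-- `sized` is the identity when the sizes agree. [folklore] -/
private theorem Network.sized_eq {d m : ℕ} (Nw : Network) (hd : Nw.nlabels = d) (hm : Nw.perLabel = m) :
    Nw.sized d m = Nw := by
  cases Nw
  simp only [Network.sized, Network.mk.injEq, and_true]
  exact ⟨hd.symm, hm.symm⟩

/-- Term lengths are preserved by `Point.map`. [folklore] -/
private theorem Point.length_map_terms {R S : Type*} [CommRing R] [CommRing S] (f : R →+* S) (P : Point R)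
    {m : ℕ} (hP : ∀ t ∈ P.terms, t.2.length = m) : ∀ t ∈ (P.map f).terms, t.2.length = m := by
  intro t ht
  simp only [Point.map, List.mem_map] at ht
  obtain ⟨t₀, ht₀, rfl⟩ := ht
  simp [hP t₀ ht₀]

/-- Term lengths are preserved by `Point.map` (indexed form). [folklore] -/
private theorem Point.length_get_map {R S : Type*} [CommRing R] [CommRing S] (f : R →+* S) (P : Point R)
    {m : ℕ} (hP : ∀ t ∈ P.terms, t.2.length = m) (t : Fin (P.map f).terms.length) :
    ((P.map f).terms.get t).2.length = m :=
  Point.length_map_terms f P hP _ (List.get_mem _ _)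

/-- Reduction modulo `p` detects nonsingularity of an integer matrix. [folklore] -/
private theorem det_ne_zero_of_map_zmod {r : ℕ} (p : ℕ) (M : Matrix (Fin r) (Fin r) ℤ)
    (h : ((Int.castRingHom (ZMod p)).mapMatrix M).det ≠ 0) : M.det ≠ 0 := by
  intro h0
  apply h
  rw [← RingHom.map_det, h0, map_zero]

/-- A square matrix with a right inverse over a nontrivial commutative ring has nonzero determinant.
[folklore] -/
private theorem det_ne_zero_of_mul_eq_one {R : Type*} [CommRing R] [Nontrivial R] {r : ℕ}
    {M B : Matrix (Fin r) (Fin r) R} (h : M * B = 1) : M.det ≠ 0 := by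
  intro h0
  have h1 := congrArg Matrix.det h
  rw [Matrix.det_mul, h0, zero_mul, Matrix.det_one] at h1
  exact zero_ne_one h1

variable {N : ℕ} [NeZero N]

/-- **Lower bound for `mult_{λ^*} K[Z̄]` from an explicit tableau certificate** (DIP 2020 §5–§6 as a
kernel statement). Data: `r` tableau networks of shape `λ` (list `lamL` = sorted parts of the
partition `lam`, at most `N` rows) passing `Network.check`, with canonical alternators, `d` labels and
`m ≠ 0` boxes per label; `r` integer points (sum-of-products presentations with `m` forms per term)
whose forms lie in the set `Z ⊆ K[x_0,…,x_{N-1}]_m`; and a nonsingular INTEGER evaluation matrix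
`(evalC P_b N_a)_{a,b}`. Conclusion: `r ≤ coordRingMultiplicity K Z m λ^*` over any field `K` of
characteristic zero, `λ^* = Weight.dualOfPartition N lam`. The highest-weight vectors are the tableau
polynomials of the networks on the reversed enumeration (`TabM.tabPoly_mem_highestWeightSpace`), their
values at the points are the integers `evalC` (`TabM.aeval_formCoeff_tabPoly`, `TabM.EC_ofNetwork`,
`evalC_map`), and §1 concludes. [cite: DorflerIkenmeyerPanova2020, §5 eqs. (5.3)–(5.6), §6 (arXiv pp. 13–15)] -/
theorem le_coordRingMultiplicity_of_certificate (K : Type) [Field K] [CharZero K] {m d r e : ℕ}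
    (hm : m ≠ 0) (lam : Nat.Partition e) (lamL : List ℕ) (hlamL : lam.sortedParts = lamL)
    (hlen : lamL.length ≤ N) (nets : Fin r → Network) (hcheck : ∀ a, (nets a).check = true)
    (hcan : ∀ a, (nets a).canonicalVars = true) (hd : ∀ a, (nets a).nlabels = d)
    (hperm : ∀ a, (nets a).perLabel = m) (hshape : ∀ a, (nets a).shape = lamL)
    (pts : Fin r → Point ℤ) (hpts : ∀ b, ∀ t ∈ (pts b).terms, t.2.length = m)
    (Z : Set (MvPolynomial (Fin N) K))
    (hZ : ∀ b, splfPoly (coefM ((pts b).map (Int.castRingHom K)))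
        (formM (finRevEnum N) ((pts b).map (Int.castRingHom K)) m) ∈ Z)
    (hdet : (Matrix.of fun a b => evalC (pts b) (nets a)).det ≠ 0) :
    r ≤ coordRingMultiplicity K Z m (Weight.dualOfPartition N lam) := by
  classical
  haveI : Infinite K := CharZero.infinite K
  set E := finRevEnum N with hE
  -- the resized networks (sizes definitionally `d`, `m`)
  let Nw : Fin r → Network := fun a => (nets a).sized d m
  have hNw : ∀ a, Nw a = nets a := fun a => (nets a).sized_eq (hd a) (hperm a)
  have hcheck' : ∀ a, (Nw a).check = true := fun a => by rw [hNw]; exact hcheck a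
  have hspec : ∀ a, (∀ c ∈ (Nw a).cols, c.vars.length = c.labels.length) ∧
      (∀ c ∈ (Nw a).cols, ∀ u ∈ c.labels, u < (Nw a).nlabels) ∧
      (∀ u, u < (Nw a).nlabels → countNat u (Nw a).allLabels = (Nw a).perLabel) :=
    fun a => Network.spec_of_check _ (hcheck' a)
  have hshape' : ∀ a, (Nw a).shape = lamL := fun a => by rw [hNw]; exact hshape a
  have hcanI : ∀ a, ∀ cl ∈ (Nw a).cols, cl.vars = List.range cl.labels.length := by
    intro a cl hcl
    have h := hcan a
    simp only [Network.canonicalVars, List.all_eq_true, beq_iff_eq] at h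
    exact h cl hcl
  -- frames, data, polynomials
  let frame : ∀ a, NetFrame (Nw a) := fun a =>
    NetFrame.ofCounts _ (hspec a).1 (hspec a).2.1 (hspec a).2.2
  let τ : ∀ a, TabM (Fin N) := fun a => TabM.ofNetwork E (Nw a) (frame a)
  let F : Fin r → MvPolynomial (DegIdx (Fin N) m) K := fun a => (τ a).tabPoly K
  -- heights and alternator variables
  have hheight : ∀ a (col : Fin (Nw a).cols.length), ((Nw a).cols.get col).vars.length ≤ N := by
    intro a col
    rw [(hspec a).1 _ (List.get_mem _ _)]
    exact le_trans (Cert.height_le_length _ _ (hshape' a) col) hlen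
  have hvars : ∀ a, ∀ cl ∈ (Nw a).cols, ∀ v ∈ cl.vars, v < N := by
    intro a cl hcl v hv
    rw [hcanI a cl hcl, List.mem_range] at hv
    obtain ⟨col, rfl⟩ := List.mem_iff_get.mp hcl
    exact lt_of_lt_of_le hv (le_trans (Cert.height_le_length _ _ (hshape' a) col) hlen)
  -- the weight at the enumerated variables
  have hχ : ∀ a, ∀ v, v < N → Weight.dualOfPartition N lam (E.x v) =
      -((Finset.univ.filter fun col : Fin (Nw a).cols.length =>
          v < ((Nw a).cols.get col).vars.length).card : ℤ) := by
    intro a v hv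
    rw [hE, dualOfPartition_finRevEnum_x N lam v hv, hlamL,
      card_filter_height_eq (Nw a) lamL (hshape' a) (hspec a).1 v]
  -- highest-weight property
  have hF : ∀ a, F a ∈ highestWeightSpace (coordRep (Fin N) K m) (Weight.dualOfPartition N lam) := by
    intro a
    refine (τ a).tabPoly_mem_highestWeightSpace (TabM.frameOfNetwork E _ _) (isAntitoneEnum_finRev N)
      (fun col => ?_) (fun col r' => ?_) _ (fun v hv => hχ a v hv)
    · exact hheight a col
    · show E.x ((((Nw a).cols.get col).vars.get r')) = E.x r'
      rw [Cert.get_vars_of_canonical _ (hcanI a _ (List.get_mem _ _))]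
  -- the points and the evaluations
  let P : Fin r → Point K := fun b => (pts b).map (Int.castRingHom K)
  let q : Fin r → MvPolynomial (Fin N) K := fun b => splfPoly (coefM (P b)) (formM E (P b) m)
  have hq : ∀ b, q b ∈ Z := fun b => hZ b
  have heval : ∀ a b, aeval (formCoeff m (q b)) (F a) = (Int.castRingHom K) (evalC (pts b) (nets a)) := by
    intro a b
    have h1 : aeval (formCoeff m (q b)) (F a) = (τ a).EC (coefM (P b)) (formM E (P b) m) :=
      (τ a).aeval_formCoeff_tabPoly (K := K) (coefM (P b)) (formM E (P b) m)
    have h2 : (τ a).EC (coefM (P b)) (formM E (P b) m) = evalC (P b) (Nw a) :=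
      TabM.EC_ofNetwork E (P b) (Nw a) (frame a)
        (Point.length_get_map (Int.castRingHom K) (pts b) (hpts b)) (hspec a).1 (hvars a)
        (hspec a).2.1 (hspec a).2.2
    rw [h1, h2]
    show evalC ((pts b).map (Int.castRingHom K)) (Nw a) = _
    rw [evalC_map, hNw]
  have hM : (Matrix.of fun a b => aeval (formCoeff m (q b)) (F a)) =
      (Int.castRingHom K).mapMatrix (Matrix.of fun a b => evalC (pts b) (nets a)) := by
    ext a b
    rw [Matrix.of_apply, RingHom.mapMatrix_apply, Matrix.map_apply, Matrix.of_apply, heval]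
  have hdet' : (Matrix.of fun a b => aeval (formCoeff m (q b)) (F a)).det ≠ 0 := by
    rw [hM, ← RingHom.map_det, eq_intCast, Int.cast_ne_zero]
    exact hdet
  exact le_coordRingMultiplicity_of_det_eval_ne_zero hm F hF q hq hdet'

end Certificate

/-! ## §5 Power-sum points lie in `Pow`: the presentation of `powPoint` is a sum of powers -/

section PowMembership

variable {N : ℕ} [NeZero N]

/-- **The form presented by a power-sum point with unit coefficients is `∑_t ℓ_t^m`**, a member of
DIP's `powerSumSet K N k m` (`k` = number of terms). [cite: DorflerIkenmeyerPanova2020, §2 (arXiv p. 3)] -/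
theorem splfPoly_powPoint_mem_powerSumSet (K : Type) [Field K] (m : ℕ) (L : List (K × List K))
    (hL : ∀ cl ∈ L, cl.1 = 1) :
    splfPoly (coefM (powPoint m L)) (formM (finRevEnum N) (powPoint m L) m) ∈
      powerSumSet K N L.length m := by
  classical
  have hlenP : (powPoint m L).terms.length = L.length := by simp [powPoint]
  -- the linear form of term `i`
  let a : Fin L.length → Fin N → K := fun i v => (L.get i).2.getD ((finRevEnum N).xinv v) 0
  refine ⟨a, ?_⟩
  unfold splfPoly
  rw [← (finCongr hlenP.symm).sum_comp]
  refine Finset.sum_congr rfl fun t _ => ?_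
  rw [finCongr_apply]
  have hget : (powPoint m L).terms.get (Fin.cast hlenP.symm t) =
      ((L.get t).1, List.replicate m (L.get t).2) := by
    rw [List.get_eq_getElem, List.get_eq_getElem]
    show (L.map fun cl => (cl.1, List.replicate m cl.2))[((Fin.cast hlenP.symm t : Fin _) : ℕ)] = _
    rw [List.getElem_map]
    rfl
  have hcoef : coefM (powPoint m L) (Fin.cast hlenP.symm t) = 1 := by
    rw [coefM, hget]
    exact hL _ (List.get_mem _ _)
  have hform : ∀ s : Fin m, formM (finRevEnum N) (powPoint m L) m (Fin.cast hlenP.symm t) s = a t := by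
    intro s
    funext v
    show (((powPoint m L).terms.get (Fin.cast hlenP.symm t)).2.getD s []).getD
      ((finRevEnum N).xinv v) 0 = _
    rw [hget]
    dsimp only
    rw [List.getD_eq_getElem (List.replicate m (L.get t).2) [] (by simp),
      List.getElem_replicate]
  rw [hcoef, map_one, one_mul, Finset.prod_congr rfl fun s _ => congrArg linForm (hform s),
    Finset.prod_const, Finset.card_univ, Fintype.card_fin]
  rfl

end PowMembership

/-! ## §6 The list form for power-sum points (what a certificate file instantiates) -/

section ListForm

variable {N : ℕ} [NeZero N]

/-- **Certificate theorem, list form, power-sum points.** A certificate file supplies: the networks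
`netsL` (shape `lamL` = sorted parts of `lam`, canonical alternators, `d` labels, `m` boxes per label),
the integer power-sum points `ptsL` (each `k` terms `(1, ℓ)`, i.e. the form `∑_{t<k} ℓ_t^m ∈ Pow_{N,k}^m`),
the table `vals` of the fast evaluator's INTEGER values (one kernel lemma per entry), and a right inverse
`B` of the table modulo `p`; conclusion `r ≤ mult_{λ^*} K[Pow_{N,k}^m]` (`coordRingMultiplicity` of
`powerSumSet K N k m`). [cite: DorflerIkenmeyerPanova2020, §6 (arXiv p. 15), Prop. 3.2 (p. 4)] -/
theorem le_coordRingMultiplicity_powerSumSet_of_listCertificate (K : Type) [Field K] [CharZero K]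
    {m d k e r : ℕ} (hm : m ≠ 0) (lam : Nat.Partition e) (lamL : List ℕ)
    (hlamL : lam.sortedParts = lamL) (hlen : lamL.length ≤ N)
    (netsL : List Network) (ptsL : List (List (ℤ × List ℤ))) (hr1 : netsL.length = r)
    (hr2 : ptsL.length = r)
    (hnets : ∀ Nw ∈ netsL, Nw.check = true ∧ Nw.canonicalVars = true ∧ Nw.nlabels = d ∧
      Nw.perLabel = m ∧ Nw.shape = lamL)
    (hptsL : ∀ L ∈ ptsL, L.length = k ∧ ∀ cl ∈ L, cl.1 = 1)
    (vals : List (List ℤ))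
    (hvals : ∀ a b : ℕ, a < r → b < r →
      evalCPow m (ptsL.getD b []) (netsL.getD a ⟨0, 0, []⟩) = (vals.getD a []).getD b 0)
    (p : ℕ) [Fact (1 < p)] (B : Matrix (Fin r) (Fin r) (ZMod p))
    (hB : (Int.castRingHom (ZMod p)).mapMatrix (Matrix.of fun a b : Fin r => (vals.getD a []).getD b 0)
      * B = 1) :
    r ≤ coordRingMultiplicity K (powerSumSet K N k m) m (Weight.dualOfPartition N lam) := by
  classical
  -- indexed data
  let nets : Fin r → Network := fun a => netsL.getD a ⟨0, 0, []⟩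
  let pts : Fin r → Point ℤ := fun b => powPoint m (ptsL.getD b [])
  have hmemN : ∀ a : Fin r, nets a ∈ netsL := fun a => by
    show netsL.getD a _ ∈ netsL
    rw [List.getD_eq_getElem _ _ (by rw [hr1]; exact a.isLt)]
    exact List.getElem_mem _
  have hmemP : ∀ b : Fin r, ptsL.getD b [] ∈ ptsL := fun b => by
    rw [List.getD_eq_getElem _ _ (by rw [hr2]; exact b.isLt)]
    exact List.getElem_mem _
  have hpts : ∀ b, ∀ t ∈ (pts b).terms, t.2.length = m := by
    intro b t ht
    simp only [pts, powPoint, List.mem_map] at ht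
    obtain ⟨cl, -, rfl⟩ := ht
    exact List.length_replicate ..
  -- the points lie in `Pow`
  have hZ : ∀ b, splfPoly (coefM ((pts b).map (Int.castRingHom K)))
      (formM (finRevEnum N) ((pts b).map (Int.castRingHom K)) m) ∈ powerSumSet K N k m := by
    intro b
    have hk := (hptsL _ (hmemP b)).1
    rw [show (pts b).map (Int.castRingHom K) = powPoint m ((ptsL.getD b []).map fun cl =>
        ((Int.castRingHom K) cl.1, cl.2.map (Int.castRingHom K))) from powPoint_map _ m _]
    have h := splfPoly_powPoint_mem_powerSumSet (N := N) K m
      ((ptsL.getD b []).map fun cl => ((Int.castRingHom K) cl.1, cl.2.map (Int.castRingHom K)))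
      (fun cl hcl => by
        obtain ⟨cl₀, h0, rfl⟩ := List.mem_map.mp hcl
        simp [(hptsL _ (hmemP b)).2 cl₀ h0])
    rwa [List.length_map, hk] at h
  -- the integer evaluation matrix is the table
  have hM : (Matrix.of fun a b => evalC (pts b) (nets a)) =
      Matrix.of fun a b : Fin r => (vals.getD a []).getD b 0 := by
    ext a b
    rw [Matrix.of_apply, Matrix.of_apply, ← hvals a b a.isLt b.isLt]
    exact (evalCPow_eq_evalC m _ _ (hnets _ (hmemN a)).1 (hnets _ (hmemN a)).2.2.2.1).symm
  have hdet : (Matrix.of fun a b => evalC (pts b) (nets a)).det ≠ 0 := by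
    rw [hM]
    exact det_ne_zero_of_map_zmod p _ (det_ne_zero_of_mul_eq_one hB)
  exact le_coordRingMultiplicity_of_certificate K hm lam lamL hlamL hlen nets
    (fun a => (hnets _ (hmemN a)).1) (fun a => (hnets _ (hmemN a)).2.1)
    (fun a => (hnets _ (hmemN a)).2.2.1) (fun a => (hnets _ (hmemN a)).2.2.2.1)
    (fun a => (hnets _ (hmemN a)).2.2.2.2) pts hpts _ hZ hdet

end ListForm

end TableauEval

end Literature.Computability.AlgebraicComplexity

end

/-! ## §7 (append) Column order is immaterial: the same theorems under the WEAK structural check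

`Network.check` (written for the engine's certificates) also asks that the columns be listed by weakly
decreasing height. That clause fixes a presentation only: the tableau polynomial `TabM.tabPoly` of
`TabM.ofNetwork` indexes columns by `Fin C` with no order, and none of `TabM.tabPoly_mem_highestWeightSpace`,
`TabM.EC_ofNetwork`, `NetFrame.ofCounts` uses it (they consume exactly the three consequences packaged in
`Network.spec_of_check`). Listing the height-1 columns FIRST makes the kernel's column-by-column
evaluation branch only at the end (measured on a degree-8 certificate on ternary septics: 27 s ↦ 2.5 s
per entry). This append restates the certificate theorems under `Network.checkWeak` (= `check` minus the
monotonicity and distinct-alternator clauses; distinctness is automatic for canonical alternators).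
[folklore] -/

namespace Literature.Computability.AlgebraicComplexity

namespace TableauEval

open MvPolynomial
open _root_.Literature.NumberTheory.DiophantineGeometry

/-- **Weak structural check** of a network: alternator lists as long as label lists, labels `< d`, every
label exactly `m` times — no condition on the ORDER of the columns. [folklore] -/
def Network.checkWeak (N : Network) : Bool :=
  (N.cols.all fun c => c.vars.length == c.labels.length)
  && (N.allLabels.all fun u => u < N.nlabels)
  && ((List.range N.nlabels).all fun u => countNat u N.allLabels == N.perLabel)

/-- What `Network.checkWeak` guarantees (the same triple as `Network.spec_of_check`). [folklore] -/
private theorem Network.spec_of_checkWeak (N : Network) (h : N.checkWeak = true) :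
    (∀ c ∈ N.cols, c.vars.length = c.labels.length) ∧
      (∀ c ∈ N.cols, ∀ u ∈ c.labels, u < N.nlabels) ∧
      (∀ u, u < N.nlabels → countNat u N.allLabels = N.perLabel) := by
  simp only [Network.checkWeak, Bool.and_eq_true, List.all_eq_true, beq_iff_eq, decide_eq_true_eq,
    List.mem_range] at h
  obtain ⟨⟨h1, h3⟩, h4⟩ := h
  refine ⟨fun c hc => h1 c hc, fun c hc u hu => h3 u ?_, h4⟩
  exact List.mem_flatMap.mpr ⟨c, hc, hu⟩

section PowLeafWeak

variable {R : Type*} [CommRing R]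

/-- `evalCPow = evalC` at power-sum points under the weak check (column order free): both compute DIP's
contraction (5.6) at `∑_t c_t ℓ_t^m`. [cite: DorflerIkenmeyerPanova2020, §5 eq. (5.6) (arXiv p. 13)] -/
theorem evalCPow_eq_evalC' (m : ℕ) (L : List (R × List R)) (N : Network) (hN : N.checkWeak = true)
    (hm : N.perLabel = m) : evalCPow m L N = evalC (powPoint m L) N := by
  obtain ⟨hvl, hlab, hcnt⟩ := Network.spec_of_checkWeak N hN
  unfold evalCPow evalC
  apply evalColsPow_eq
  · exact hvl
  · intro c hc u hu
    rw [List.length_replicate]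
    exact hlab c hc u hu
  · intro u hu
    rw [List.length_replicate] at hu
    rw [List.getD_eq_getElem _ _ (by simpa using hu), List.getElem_replicate, List.length_nil,
      zero_add, ← hm]
    exact hcnt u hu


end PowLeafWeak

section CertificateWeak

variable {N : ℕ} [NeZero N]

/-- **Lower bound for `mult_{λ^*} K[Z̄]` from an explicit tableau certificate, weak structural check**
(columns in any order; otherwise verbatim `le_coordRingMultiplicity_of_certificate`).
[cite: DorflerIkenmeyerPanova2020, §5 eqs. (5.3)–(5.6), §6 (arXiv pp. 13–15)] -/
theorem le_coordRingMultiplicity_of_certificate' (K : Type) [Field K] [CharZero K] {m d r e : ℕ}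
    (hm : m ≠ 0) (lam : Nat.Partition e) (lamL : List ℕ) (hlamL : lam.sortedParts = lamL)
    (hlen : lamL.length ≤ N) (nets : Fin r → Network) (hcheck : ∀ a, (nets a).checkWeak = true)
    (hcan : ∀ a, (nets a).canonicalVars = true) (hd : ∀ a, (nets a).nlabels = d)
    (hperm : ∀ a, (nets a).perLabel = m) (hshape : ∀ a, (nets a).shape = lamL)
    (pts : Fin r → Point ℤ) (hpts : ∀ b, ∀ t ∈ (pts b).terms, t.2.length = m)
    (Z : Set (MvPolynomial (Fin N) K))
    (hZ : ∀ b, splfPoly (coefM ((pts b).map (Int.castRingHom K)))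
        (formM (finRevEnum N) ((pts b).map (Int.castRingHom K)) m) ∈ Z)
    (hdet : (Matrix.of fun a b => evalC (pts b) (nets a)).det ≠ 0) :
    r ≤ coordRingMultiplicity K Z m (Weight.dualOfPartition N lam) := by
  classical
  haveI : Infinite K := CharZero.infinite K
  set E := finRevEnum N with hE
  -- the resized networks (sizes definitionally `d`, `m`)
  let Nw : Fin r → Network := fun a => (nets a).sized d m
  have hNw : ∀ a, Nw a = nets a := fun a => (nets a).sized_eq (hd a) (hperm a)
  have hcheck' : ∀ a, (Nw a).checkWeak = true := fun a => by rw [hNw]; exact hcheck a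
  have hspec : ∀ a, (∀ c ∈ (Nw a).cols, c.vars.length = c.labels.length) ∧
      (∀ c ∈ (Nw a).cols, ∀ u ∈ c.labels, u < (Nw a).nlabels) ∧
      (∀ u, u < (Nw a).nlabels → countNat u (Nw a).allLabels = (Nw a).perLabel) :=
    fun a => Network.spec_of_checkWeak _ (hcheck' a)
  have hshape' : ∀ a, (Nw a).shape = lamL := fun a => by rw [hNw]; exact hshape a
  have hcanI : ∀ a, ∀ cl ∈ (Nw a).cols, cl.vars = List.range cl.labels.length := by
    intro a cl hcl
    have h := hcan a
    simp only [Network.canonicalVars, List.all_eq_true, beq_iff_eq] at h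
    exact h cl hcl
  -- frames, data, polynomials
  let frame : ∀ a, NetFrame (Nw a) := fun a =>
    NetFrame.ofCounts _ (hspec a).1 (hspec a).2.1 (hspec a).2.2
  let τ : ∀ a, TabM (Fin N) := fun a => TabM.ofNetwork E (Nw a) (frame a)
  let F : Fin r → MvPolynomial (DegIdx (Fin N) m) K := fun a => (τ a).tabPoly K
  -- heights and alternator variables
  have hheight : ∀ a (col : Fin (Nw a).cols.length), ((Nw a).cols.get col).vars.length ≤ N := by
    intro a col
    rw [(hspec a).1 _ (List.get_mem _ _)]
    exact le_trans (Cert.height_le_length _ _ (hshape' a) col) hlen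
  have hvars : ∀ a, ∀ cl ∈ (Nw a).cols, ∀ v ∈ cl.vars, v < N := by
    intro a cl hcl v hv
    rw [hcanI a cl hcl, List.mem_range] at hv
    obtain ⟨col, rfl⟩ := List.mem_iff_get.mp hcl
    exact lt_of_lt_of_le hv (le_trans (Cert.height_le_length _ _ (hshape' a) col) hlen)
  -- the weight at the enumerated variables
  have hχ : ∀ a, ∀ v, v < N → Weight.dualOfPartition N lam (E.x v) =
      -((Finset.univ.filter fun col : Fin (Nw a).cols.length =>
          v < ((Nw a).cols.get col).vars.length).card : ℤ) := by
    intro a v hv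
    rw [hE, dualOfPartition_finRevEnum_x N lam v hv, hlamL,
      card_filter_height_eq (Nw a) lamL (hshape' a) (hspec a).1 v]
  -- highest-weight property
  have hF : ∀ a, F a ∈ highestWeightSpace (coordRep (Fin N) K m) (Weight.dualOfPartition N lam) := by
    intro a
    refine (τ a).tabPoly_mem_highestWeightSpace (TabM.frameOfNetwork E _ _) (isAntitoneEnum_finRev N)
      (fun col => ?_) (fun col r' => ?_) _ (fun v hv => hχ a v hv)
    · exact hheight a col
    · show E.x ((((Nw a).cols.get col).vars.get r')) = E.x r'
      rw [Cert.get_vars_of_canonical _ (hcanI a _ (List.get_mem _ _))]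
  -- the points and the evaluations
  let P : Fin r → Point K := fun b => (pts b).map (Int.castRingHom K)
  let q : Fin r → MvPolynomial (Fin N) K := fun b => splfPoly (coefM (P b)) (formM E (P b) m)
  have hq : ∀ b, q b ∈ Z := fun b => hZ b
  have heval : ∀ a b, aeval (formCoeff m (q b)) (F a) = (Int.castRingHom K) (evalC (pts b) (nets a)) := by
    intro a b
    have h1 : aeval (formCoeff m (q b)) (F a) = (τ a).EC (coefM (P b)) (formM E (P b) m) :=
      (τ a).aeval_formCoeff_tabPoly (K := K) (coefM (P b)) (formM E (P b) m)
    have h2 : (τ a).EC (coefM (P b)) (formM E (P b) m) = evalC (P b) (Nw a) :=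
      TabM.EC_ofNetwork E (P b) (Nw a) (frame a)
        (Point.length_get_map (Int.castRingHom K) (pts b) (hpts b)) (hspec a).1 (hvars a)
        (hspec a).2.1 (hspec a).2.2
    rw [h1, h2]
    show evalC ((pts b).map (Int.castRingHom K)) (Nw a) = _
    rw [evalC_map, hNw]
  have hM : (Matrix.of fun a b => aeval (formCoeff m (q b)) (F a)) =
      (Int.castRingHom K).mapMatrix (Matrix.of fun a b => evalC (pts b) (nets a)) := by
    ext a b
    rw [Matrix.of_apply, RingHom.mapMatrix_apply, Matrix.map_apply, Matrix.of_apply, heval]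
  have hdet' : (Matrix.of fun a b => aeval (formCoeff m (q b)) (F a)).det ≠ 0 := by
    rw [hM, ← RingHom.map_det, eq_intCast, Int.cast_ne_zero]
    exact hdet
  exact le_coordRingMultiplicity_of_det_eval_ne_zero hm F hF q hq hdet'


end CertificateWeak

section ListFormWeak

variable {N : ℕ} [NeZero N]

/-- **Certificate theorem, list form, power-sum points, weak structural check** (columns in any order;
otherwise verbatim `le_coordRingMultiplicity_powerSumSet_of_listCertificate`).
[cite: DorflerIkenmeyerPanova2020, §6 (arXiv p. 15), Prop. 3.2 (p. 4)] -/
theorem le_coordRingMultiplicity_powerSumSet_of_listCertificate' (K : Type) [Field K] [CharZero K]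
    {m d k e r : ℕ} (hm : m ≠ 0) (lam : Nat.Partition e) (lamL : List ℕ)
    (hlamL : lam.sortedParts = lamL) (hlen : lamL.length ≤ N)
    (netsL : List Network) (ptsL : List (List (ℤ × List ℤ))) (hr1 : netsL.length = r)
    (hr2 : ptsL.length = r)
    (hnets : ∀ Nw ∈ netsL, Nw.checkWeak = true ∧ Nw.canonicalVars = true ∧ Nw.nlabels = d ∧
      Nw.perLabel = m ∧ Nw.shape = lamL)
    (hptsL : ∀ L ∈ ptsL, L.length = k ∧ ∀ cl ∈ L, cl.1 = 1)
    (vals : List (List ℤ))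
    (hvals : ∀ a b : ℕ, a < r → b < r →
      evalCPow m (ptsL.getD b []) (netsL.getD a ⟨0, 0, []⟩) = (vals.getD a []).getD b 0)
    (p : ℕ) [Fact (1 < p)] (B : Matrix (Fin r) (Fin r) (ZMod p))
    (hB : (Int.castRingHom (ZMod p)).mapMatrix (Matrix.of fun a b : Fin r => (vals.getD a []).getD b 0)
      * B = 1) :
    r ≤ coordRingMultiplicity K (powerSumSet K N k m) m (Weight.dualOfPartition N lam) := by
  classical
  -- indexed data
  let nets : Fin r → Network := fun a => netsL.getD a ⟨0, 0, []⟩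
  let pts : Fin r → Point ℤ := fun b => powPoint m (ptsL.getD b [])
  have hmemN : ∀ a : Fin r, nets a ∈ netsL := fun a => by
    show netsL.getD a _ ∈ netsL
    rw [List.getD_eq_getElem _ _ (by rw [hr1]; exact a.isLt)]
    exact List.getElem_mem _
  have hmemP : ∀ b : Fin r, ptsL.getD b [] ∈ ptsL := fun b => by
    rw [List.getD_eq_getElem _ _ (by rw [hr2]; exact b.isLt)]
    exact List.getElem_mem _
  have hpts : ∀ b, ∀ t ∈ (pts b).terms, t.2.length = m := by
    intro b t ht
    simp only [pts, powPoint, List.mem_map] at ht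
    obtain ⟨cl, -, rfl⟩ := ht
    exact List.length_replicate ..
  -- the points lie in `Pow`
  have hZ : ∀ b, splfPoly (coefM ((pts b).map (Int.castRingHom K)))
      (formM (finRevEnum N) ((pts b).map (Int.castRingHom K)) m) ∈ powerSumSet K N k m := by
    intro b
    have hk := (hptsL _ (hmemP b)).1
    rw [show (pts b).map (Int.castRingHom K) = powPoint m ((ptsL.getD b []).map fun cl =>
        ((Int.castRingHom K) cl.1, cl.2.map (Int.castRingHom K))) from powPoint_map _ m _]
    have h := splfPoly_powPoint_mem_powerSumSet (N := N) K m
      ((ptsL.getD b []).map fun cl => ((Int.castRingHom K) cl.1, cl.2.map (Int.castRingHom K)))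
      (fun cl hcl => by
        obtain ⟨cl₀, h0, rfl⟩ := List.mem_map.mp hcl
        simp [(hptsL _ (hmemP b)).2 cl₀ h0])
    rwa [List.length_map, hk] at h
  -- the integer evaluation matrix is the table
  have hM : (Matrix.of fun a b => evalC (pts b) (nets a)) =
      Matrix.of fun a b : Fin r => (vals.getD a []).getD b 0 := by
    ext a b
    rw [Matrix.of_apply, Matrix.of_apply, ← hvals a b a.isLt b.isLt]
    exact (evalCPow_eq_evalC' m _ _ (hnets _ (hmemN a)).1 (hnets _ (hmemN a)).2.2.2.1).symm
  have hdet : (Matrix.of fun a b => evalC (pts b) (nets a)).det ≠ 0 := by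
    rw [hM]
    exact det_ne_zero_of_map_zmod p _ (det_ne_zero_of_mul_eq_one hB)
  exact le_coordRingMultiplicity_of_certificate' K hm lam lamL hlamL hlen nets
    (fun a => (hnets _ (hmemN a)).1) (fun a => (hnets _ (hmemN a)).2.1)
    (fun a => (hnets _ (hmemN a)).2.2.1) (fun a => (hnets _ (hmemN a)).2.2.2.1)
    (fun a => (hnets _ (hmemN a)).2.2.2.2) pts hpts _ hZ hdet


end ListFormWeak

end TableauEval

end Literature.Computability.AlgebraicComplexity
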